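import Summits.QuantumFields.YangMills.Theorems.ColdStartUniversalityLatticeLangevinRiemannLipschitzContraction
import Summits.QuantumFields.YangMills.Theorems.ColdStartUniversalityUniformColdStartMixingFixedCutoffMixingTimeWindow
import HarnessLib

/-!
# Route `ColdStartUniversality` (fixed-cut-off package): the `W₁`/Lipschitz form of Shen–Zhu–Zhu's Theorem 4.2 (4.5) AT THE ROUTE'S CUT-OFFS,
# inside the strong-coupling window `γε_K > 6`:  `Lip_(ρ_L)(P^(K)_t F) ≤ exp(−(1 − 6/(γε_K))·t) · Lip_(ρ_L)(F)` in lattice time `t`,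
# i.e. `exp(−(1 − 6/(γε_K))·s/ε_K)` in physical time `s = ε_K t`

Planner-facing helper file (seat `ym-line-csu-p1`, g41, file G48; `--supports stmt-QuantumFields-24809`).  G44's
`wilson_riemannLipschitz_contraction_uniform` at the route's `K`-th cut-off: lattice `(ℤ/L_K)³`, `L_K = (F.P K).sitesPerDir 0`, SZZ coupling
`β'_K = (γε_K)⁻¹/2`; in the window `6 < γε_K` one has `|β'_K| < 1/12` and `1 − 12|β'_K| = 1 − 6/(γε_K)` (`window_coupling_bounds`).

* ★★ `riemannLipschitz_contraction_fixedCutoff_window` — for every cut-off `K` with `6 < γε_K`, every realising Markov kernel family of the SZZ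
  dynamics at `β'_K` on the `K`-th lattice, every `C⁵` cylinder function `F = f∘coords` that is `L_F`-Lipschitz for `ρ_L`, every lattice time `t`
  and all `Q, Q'`:  `|P_t F(Q) − P_t F(Q')| ≤ exp(−(1 − 6/(γε_K))·t) · L_F · ρ_L(Q,Q')`;
* ★★ `riemannLipschitz_contraction_fixedCutoff_window_physical` — the same with the lattice time written as `s/ε_K` for a physical time `s ≥ 0`:
  rate `(1 − 6/(γε_K))/ε_K` per unit PHYSICAL time.

THEOREMS ONLY, no definition, no sorry.  PLANNER-FACING, HONEST: a WINDOW statement — `6 < γε_K` holds only for the coarse cut-offs (it fails as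
`ε_K → 0` at fixed `γ`), so this is NOT uniform in `K` in the sense of `UniformColdStartMixing` (stmt-24809, ASIDE, NOT restated or weakened); inside
the window the physical rate `(1 − 6/(γε_K))/ε_K` is bounded below by `(1 − 6/(γε_K₀))/ε_K₀`-type constants only cut-off by cut-off; no crux, rung or
summit statement is proved; the Yang–Mills mass gap is NOT proved.
-/

set_option autoImplicit false

noncomputable section

namespace Summit.QuantumFields.YangMills.Theorems.ColdStartUniversality

open MeasureTheory ProbabilityTheory Matrix Complex Finset Filter Topology Set
open scoped ComplexConjugate BigOperators Real NNReal ENNReal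
open Literature.Probability.Process Literature.MathematicalPhysics.QuantumFieldTheory
open Literature.MathematicalPhysics.QuantumFieldTheory.Balaban1983to89
open Literature.MathematicalPhysics.QuantumLattice (fundamentalRep fundamentalLatticeRep continuous_fundamentalRep fundamentalRep_apply fundamentalLatticeRep_N)

/-- ★★ **Contraction of the `ρ_L`-Lipschitz seminorm at the route's cut-offs, window `γε_K > 6` (lattice time).**  For every cut-off `K` with
`6 < γε_K`, every realising kernel family `κ` of the SZZ dynamics at `β'_K = (γε_K)⁻¹/2` on `(ℤ/L_K)³`, every `C⁵` cylinder function `F = f∘coords`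
that is `L_F`-Lipschitz for Shen–Zhu–Zhu's `ρ_L`, every lattice time `t`, all `Q, Q'`:
`|∫F dκ_t(Q) − ∫F dκ_t(Q')| ≤ exp(−(1 − 6/(γε_K))·t) · L_F · ρ_L(Q,Q')`.  The Yang–Mills mass gap is NOT proved. [cite: ShenZhuZhu2022, Theorem 4.2 (4.5)] -/
theorem riemannLipschitz_contraction_fixedCutoff_window (F : T3ContinuumYM3Torus.T3Family) (γ : ℝ) (K : ℕ) (hK : 6 < γ * (F.P K).eps)
    (Q Q' : GaugeConfig 3 ((F.P K).sitesPerDir 0) (Matrix.specialUnitaryGroup (Fin 2) ℂ)) (t : ℝ≥0) {Lf : ℝ} (hLf : 0 ≤ Lf)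
    (κ : ℝ≥0 → Kernel (GaugeConfig 3 ((F.P K).sitesPerDir 0) (Matrix.specialUnitaryGroup (Fin 2) ℂ))
      (GaugeConfig 3 ((F.P K).sitesPerDir 0) (Matrix.specialUnitaryGroup (Fin 2) ℂ))) [∀ t, IsMarkovKernel (κ t)]
    (hreal : ∀ (t : ℝ≥0) (x : GaugeConfig 3 ((F.P K).sitesPerDir 0) (Matrix.specialUnitaryGroup (Fin 2) ℂ))
        (Ω : Type) [MeasurableSpace Ω] (P : Measure Ω) [IsProbabilityMeasure P]
        (W : ℝ≥0 → Ω → (Edge 3 ((F.P K).sitesPerDir 0) × NoiseIdx 2 → ℝ)) (hW : IsFlatBrownian W P)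
        (U : ℝ≥0 → Ω → GaugeConfig 3 ((F.P K).sitesPerDir 0) (Matrix.specialUnitaryGroup (Fin 2) ℂ)),
        (∀ ω, U 0 ω = x) →
        (latticeLangevinDynamics (fundamentalLatticeRep 2) ((γ * (F.P K).eps)⁻¹ / 2)).IsSolution (fundamentalRep (Fin 2))
          hW.natFiltration P W U →
        κ t x = P.map (U t))
    {f : (Edge 3 ((F.P K).sitesPerDir 0) × Fin 2 × Fin 2 × Bool → ℝ) → ℝ} (hf : ContDiff ℝ 5 f) :
    let coords : GaugeConfig 3 ((F.P K).sitesPerDir 0) (Matrix.specialUnitaryGroup (Fin 2) ℂ) → (Edge 3 ((F.P K).sitesPerDir 0) × Fin 2 × Fin 2 × Bool → ℝ) :=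
      fun V q => (fun z : ℂ => if q.2.2.2 then z.im else z.re)
        ((fundamentalRep (Fin 2) (V q.1) : Matrix (Fin 2) (Fin 2) ℂ) q.2.1 q.2.2.1)
    (∀ Q Q' : GaugeConfig 3 ((F.P K).sitesPerDir 0) (Matrix.specialUnitaryGroup (Fin 2) ℂ),
      |f (coords Q') - f (coords Q)| ≤ Lf * Real.sqrt (torusRiemannDistSq (fundamentalLatticeRep 2) Q Q')) →
      |∫ y, f (coords y) ∂(κ t Q) - ∫ y, f (coords y) ∂(κ t Q')| ≤
        Real.exp (-((1 - 6 / (γ * (F.P K).eps)) * (t : ℝ))) * Lf * Real.sqrt (torusRiemannDistSq (fundamentalLatticeRep 2) Q Q') := by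
  intro coords hlip
  obtain ⟨hβ, hrate⟩ := window_coupling_bounds F γ K hK
  have h := wilson_riemannLipschitz_contraction_uniform ((F.P K).sitesPerDir 0) Q Q' t hLf ((γ * (F.P K).eps)⁻¹ / 2) hβ κ hreal hf hlip
  rw [hrate] at h
  exact h

/-- ★★ **The same in PHYSICAL time**: for a physical time `s ≥ 0` (lattice time `s/ε_K`),
`|P_(s/ε_K) F(Q) − P_(s/ε_K) F(Q')| ≤ exp(−(1 − 6/(γε_K))·s/ε_K) · L_F · ρ_L(Q,Q')` — rate `(1 − 6/(γε_K))/ε_K` per unit physical time inside the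
window.  The Yang–Mills mass gap is NOT proved. [cite: ShenZhuZhu2022, Theorem 4.2 (4.5)] -/
theorem riemannLipschitz_contraction_fixedCutoff_window_physical (F : T3ContinuumYM3Torus.T3Family) (γ : ℝ) (K : ℕ) (hK : 6 < γ * (F.P K).eps)
    (Q Q' : GaugeConfig 3 ((F.P K).sitesPerDir 0) (Matrix.specialUnitaryGroup (Fin 2) ℂ)) {s : ℝ} (hs : 0 ≤ s) {Lf : ℝ} (hLf : 0 ≤ Lf)
    (κ : ℝ≥0 → Kernel (GaugeConfig 3 ((F.P K).sitesPerDir 0) (Matrix.specialUnitaryGroup (Fin 2) ℂ))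
      (GaugeConfig 3 ((F.P K).sitesPerDir 0) (Matrix.specialUnitaryGroup (Fin 2) ℂ))) [∀ t, IsMarkovKernel (κ t)]
    (hreal : ∀ (t : ℝ≥0) (x : GaugeConfig 3 ((F.P K).sitesPerDir 0) (Matrix.specialUnitaryGroup (Fin 2) ℂ))
        (Ω : Type) [MeasurableSpace Ω] (P : Measure Ω) [IsProbabilityMeasure P]
        (W : ℝ≥0 → Ω → (Edge 3 ((F.P K).sitesPerDir 0) × NoiseIdx 2 → ℝ)) (hW : IsFlatBrownian W P)
        (U : ℝ≥0 → Ω → GaugeConfig 3 ((F.P K).sitesPerDir 0) (Matrix.specialUnitaryGroup (Fin 2) ℂ)),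
        (∀ ω, U 0 ω = x) →
        (latticeLangevinDynamics (fundamentalLatticeRep 2) ((γ * (F.P K).eps)⁻¹ / 2)).IsSolution (fundamentalRep (Fin 2))
          hW.natFiltration P W U →
        κ t x = P.map (U t))
    {f : (Edge 3 ((F.P K).sitesPerDir 0) × Fin 2 × Fin 2 × Bool → ℝ) → ℝ} (hf : ContDiff ℝ 5 f) :
    let coords : GaugeConfig 3 ((F.P K).sitesPerDir 0) (Matrix.specialUnitaryGroup (Fin 2) ℂ) → (Edge 3 ((F.P K).sitesPerDir 0) × Fin 2 × Fin 2 × Bool → ℝ) :=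
      fun V q => (fun z : ℂ => if q.2.2.2 then z.im else z.re)
        ((fundamentalRep (Fin 2) (V q.1) : Matrix (Fin 2) (Fin 2) ℂ) q.2.1 q.2.2.1)
    (∀ Q Q' : GaugeConfig 3 ((F.P K).sitesPerDir 0) (Matrix.specialUnitaryGroup (Fin 2) ℂ),
      |f (coords Q') - f (coords Q)| ≤ Lf * Real.sqrt (torusRiemannDistSq (fundamentalLatticeRep 2) Q Q')) →
      |∫ y, f (coords y) ∂(κ ⟨s / (F.P K).eps, div_nonneg hs (F.P K).eps_pos.le⟩ Q) -
          ∫ y, f (coords y) ∂(κ ⟨s / (F.P K).eps, div_nonneg hs (F.P K).eps_pos.le⟩ Q')| ≤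
        Real.exp (-((1 - 6 / (γ * (F.P K).eps)) * (s / (F.P K).eps))) * Lf * Real.sqrt (torusRiemannDistSq (fundamentalLatticeRep 2) Q Q') := by
  intro coords hlip
  exact riemannLipschitz_contraction_fixedCutoff_window F γ K hK Q Q' ⟨s / (F.P K).eps, div_nonneg hs (F.P K).eps_pos.le⟩ hLf κ hreal hf hlip

end Summit.QuantumFields.YangMills.Theorems.ColdStartUniversality

end
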